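import Summits.Ventures.PercRepro0.Russo

/-!
# P10 · BK-INCREASING in Lean, 1/2: the van den Berg–Kesten inequality on a finite set of coordinates (seat p2)

The finite combinatorial core of the disjoint-occurrence inequality, on the polynomial `locC` of `LocalLaw.lean` /
`Russo.lean` (p4): for a finite set `E` of coordinates, monotone predicates `𝒜 ℬ : Finset ι → Prop` and `q ∈ [0,1]`,

  `locC E (DisjOcc 𝒜 ℬ) q ≤ locC E 𝒜 q · locC E ℬ q`      (`locC_disjOcc_le`),

where `DisjOcc 𝒜 ℬ η := ∃ U V ⊆ η, Disjoint U V ∧ 𝒜 U ∧ ℬ V` is «`𝒜` and `ℬ` occur disjointly in `η`» (for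
increasing events this is the cylinder form `[η]_U ⊆ 𝒜`, `[η]_V ⊆ ℬ` of AB87 p.503 ℓ17–21 — see `BK.lean`).

**Proof** (van den Berg–Kesten's interpolation). For `K ⊆ E` (the «split» coordinates) consider two independent
copies `η, η'` of the configuration and the event

  `E_K(η, η') := ∃ U V, U ⊆ η ∧ V ⊆ hyb K η η' ∧ Disjoint (U \ K) (V \ K) ∧ 𝒜 U ∧ ℬ V`,

where `hyb K η η' = (η' ∩ K) ∪ (η \ K)` is the hybrid configuration (`η'` on `K`, `η` elsewhere): `𝒜` is witnessed
in the first copy, `ℬ` in the hybrid, and the witnesses must be disjoint only on the unsplit coordinates.  Then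
`E_∅ = 𝒜 ∘ ℬ` (in the first copy, `EK_empty_iff`), `E_E = {𝒜 η} ∩ {ℬ η'}` (independent copies, `EK_self_iff`), and
the doubled sum `dsum E K = ∑_{η, η' ⊆ E} 1[E_K(η, η')] wt E η q · wt E η' q` is NONDECREASING in `K`
(`dsum_le_dsum_insert`): splitting one more coordinate `k ∉ K`, a four-case analysis on the pair `(ω_k, ω'_k)`
(`step_pointwise`) — if `E_K` holds with `k` closed, the witnesses avoid `k` and `E_{K ∪ k}` holds whatever the two
copies do at `k` (`EK_insert_of_notMem`); if `E_K` needs `k` open, the witness containing `k` (exactly one of `U`, `V`,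
by disjointness) is served by the copy it reads (`EK_insert_of_mem_left` / `EK_insert_of_notMem_left`), so `E_{K ∪ k}`
holds with conditional probability at least `q`; the other cases are trivial.  Hence
`locC E (DisjOcc 𝒜 ℬ) q = dsum E ∅ ≤ dsum E E = locC E 𝒜 q · locC E ℬ q`.

Continued in `BK.lean` (events on configurations, the transfer to `setBernoulli` and to `Defs`).
Namespace `Summit.Ventures.PercRepro0.BKFinite`. Nothing here claims anything about `T(d)`.
-/

namespace Summit.Ventures.PercRepro0.BKFinite

open MeasureTheory ProbabilityTheory unitInterval Set
open Summit.Ventures.PercRepro0.Defs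
open Summit.Ventures.PercRepro0.Russo
open scoped ENNReal NNReal Classical

variable {ι : Type*}

/-! ### Disjoint occurrence on the subsets of a finite set -/

/-- `𝒜 ∘ ℬ` on finite configurations: `η` contains two disjoint sub-configurations, one in `𝒜`, one in `ℬ`. -/
def DisjOcc (𝒜 ℬ : Finset ι → Prop) (η : Finset ι) : Prop :=
  ∃ U V : Finset ι, U ⊆ η ∧ V ⊆ η ∧ Disjoint U V ∧ 𝒜 U ∧ ℬ V

/-- The hybrid configuration: `η'` on the split coordinates `K`, `η` elsewhere. -/
def hyb [DecidableEq ι] (K η η' : Finset ι) : Finset ι := (η' ∩ K) ∪ (η \ K)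

/-- The interpolating event `E_K`: `𝒜` is witnessed inside `η`, `ℬ` inside the hybrid `hyb K η η'`, and the two
witnesses are disjoint off the split coordinates `K`. -/
def EK [DecidableEq ι] (K : Finset ι) (𝒜 ℬ : Finset ι → Prop) (η η' : Finset ι) : Prop :=
  ∃ U V : Finset ι, U ⊆ η ∧ V ⊆ hyb K η η' ∧ Disjoint (U \ K) (V \ K) ∧ 𝒜 U ∧ ℬ V

/-- The doubled sum `∑_{η, η' ⊆ E} 1[E_K(η, η')] · wt E η q · wt E η' q`. -/
noncomputable def dsum [DecidableEq ι] (E K : Finset ι) (𝒜 ℬ : Finset ι → Prop) (q : ℝ) : ℝ :=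
  ∑ η ∈ E.powerset, ∑ η' ∈ E.powerset, if EK K 𝒜 ℬ η η' then wt E η q * wt E η' q else 0

/-- No split coordinates: the hybrid is the first copy. -/
theorem hyb_empty [DecidableEq ι] (η η' : Finset ι) : hyb ∅ η η' = η := by
  simp [hyb]

/-- `E_∅` is disjoint occurrence in the first copy. -/
theorem EK_empty_iff [DecidableEq ι] (𝒜 ℬ : Finset ι → Prop) (η η' : Finset ι) :
    EK ∅ 𝒜 ℬ η η' ↔ DisjOcc 𝒜 ℬ η := by
  simp [EK, DisjOcc, hyb_empty]

/-- All coordinates split: the hybrid is the second copy. -/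
theorem hyb_self [DecidableEq ι] {E η η' : Finset ι} (hη : η ⊆ E) (hη' : η' ⊆ E) : hyb E η η' = η' := by
  ext e
  simp only [hyb, Finset.mem_union, Finset.mem_inter, Finset.mem_sdiff]
  constructor
  · rintro (⟨h, _⟩ | ⟨h, hE⟩)
    · exact h
    · exact absurd (hη h) hE
  · intro h
    exact Or.inl ⟨h, hη' h⟩

/-- `E_E` is the product event `{𝒜 η} ∩ {ℬ η'}` for monotone `𝒜`, `ℬ`. -/
theorem EK_self_iff [DecidableEq ι] {E : Finset ι} {𝒜 ℬ : Finset ι → Prop}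
    (hmonoA : ∀ η ζ, η ⊆ ζ → 𝒜 η → 𝒜 ζ) (hmonoB : ∀ η ζ, η ⊆ ζ → ℬ η → ℬ ζ)
    {η η' : Finset ι} (hη : η ⊆ E) (hη' : η' ⊆ E) :
    EK E 𝒜 ℬ η η' ↔ 𝒜 η ∧ ℬ η' := by
  constructor
  · rintro ⟨U, V, hU, hV, _, hA, hB⟩
    rw [hyb_self hη hη'] at hV
    exact ⟨hmonoA U η hU hA, hmonoB V η' hV hB⟩
  · rintro ⟨hA, hB⟩
    refine ⟨η, η', subset_rfl, by rw [hyb_self hη hη'], ?_, hA, hB⟩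
    rw [Finset.sdiff_eq_empty_iff_subset.2 hη]
    exact Finset.disjoint_empty_left _

/-- The right coordinate `k ∉ K` does not enter the hybrid. -/
theorem hyb_insert_right [DecidableEq ι] {K : Finset ι} {k : ι} (hkK : k ∉ K) (η η' : Finset ι) :
    hyb K η (insert k η') = hyb K η η' := by
  unfold hyb
  rw [Finset.insert_inter_of_notMem hkK]

/-- The right coordinate `k ∉ K` is irrelevant for `E_K`. -/
theorem EK_insert_right [DecidableEq ι] {K : Finset ι} {k : ι} (hkK : k ∉ K) (𝒜 ℬ : Finset ι → Prop)
    (η η' : Finset ι) : EK K 𝒜 ℬ η (insert k η') ↔ EK K 𝒜 ℬ η η' := by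
  unfold EK
  rw [hyb_insert_right hkK]

/-! ### The three transfer lemmas of the one-coordinate step -/

/-- Case A: if `E_K` holds with `k ∉ η` (the witnesses avoid `k`), then `E_{K ∪ k}` holds for any enlargement of
the two copies. -/
theorem EK_insert_of_notMem [DecidableEq ι] {K : Finset ι} {k : ι} (hkK : k ∉ K) {𝒜 ℬ : Finset ι → Prop}
    {η η' η₁ η₁' : Finset ι} (hkη : k ∉ η) (h : EK K 𝒜 ℬ η η') (hη₁ : η ⊆ η₁) (hη₁' : η' ⊆ η₁') :
    EK (insert k K) 𝒜 ℬ η₁ η₁' := by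
  obtain ⟨U, V, hU, hV, hdisj, hA, hB⟩ := h
  refine ⟨U, V, hU.trans hη₁, ?_, ?_, hA, hB⟩
  · intro j hj
    have hj' := hV hj
    simp only [hyb, Finset.mem_union, Finset.mem_inter, Finset.mem_sdiff, Finset.mem_insert] at hj' ⊢
    have hjk : j ≠ k := by
      rintro rfl
      rcases hj' with ⟨_, hK⟩ | ⟨hη, _⟩
      · exact hkK hK
      · exact hkη hη
    rcases hj' with ⟨hη', hK⟩ | ⟨hη, hK⟩
    · exact Or.inl ⟨hη₁' hη', Or.inr hK⟩
    · exact Or.inr ⟨hη₁ hη, fun h => h.elim hjk hK⟩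
  · exact hdisj.mono (Finset.sdiff_subset_sdiff subset_rfl (Finset.subset_insert k K))
      (Finset.sdiff_subset_sdiff subset_rfl (Finset.subset_insert k K))

/-- Case B1: `k` lies in the `𝒜`-witness `U` (so not in `V`): `E_{K ∪ k}` holds for the same first copy and any
enlargement of the second. -/
theorem EK_insert_of_mem_left [DecidableEq ι] {K : Finset ι} {k : ι} (hkK : k ∉ K) {𝒜 ℬ : Finset ι → Prop}
    {η η' η₁' U V : Finset ι} (hU : U ⊆ η) (hV : V ⊆ hyb K η η') (hdisj : Disjoint (U \ K) (V \ K))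
    (hA : 𝒜 U) (hB : ℬ V) (hkU : k ∈ U) (hη₁' : η' ⊆ η₁') :
    EK (insert k K) 𝒜 ℬ η η₁' := by
  have hkV : k ∉ V := fun hkV =>
    Finset.disjoint_left.1 hdisj (Finset.mem_sdiff.2 ⟨hkU, hkK⟩) (Finset.mem_sdiff.2 ⟨hkV, hkK⟩)
  refine ⟨U, V, hU, ?_, hdisj.mono (Finset.sdiff_subset_sdiff subset_rfl (Finset.subset_insert k K))
      (Finset.sdiff_subset_sdiff subset_rfl (Finset.subset_insert k K)), hA, hB⟩
  intro j hj
  have hjk : j ≠ k := fun h => hkV (h ▸ hj)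
  have hj' := hV hj
  simp only [hyb, Finset.mem_union, Finset.mem_inter, Finset.mem_sdiff, Finset.mem_insert] at hj' ⊢
  rcases hj' with ⟨hη', hK⟩ | ⟨hη, hK⟩
  · exact Or.inl ⟨hη₁' hη', Or.inr hK⟩
  · exact Or.inr ⟨hη, fun h => h.elim hjk hK⟩

/-- Case B2: `k` is not in the `𝒜`-witness: `E_{K ∪ k}` holds with `k` open in the second copy, for any first
copy containing `η ∖ {k}`. -/
theorem EK_insert_of_notMem_left [DecidableEq ι] {K : Finset ι} {k : ι} {𝒜 ℬ : Finset ι → Prop}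
    {η η' η₁ U V : Finset ι} (hU : U ⊆ η) (hV : V ⊆ hyb K η η') (hdisj : Disjoint (U \ K) (V \ K))
    (hA : 𝒜 U) (hB : ℬ V) (hkU : k ∉ U) (hη₁ : ∀ j ∈ η, j ≠ k → j ∈ η₁) :
    EK (insert k K) 𝒜 ℬ η₁ (insert k η') := by
  refine ⟨U, V, fun i hi => hη₁ i (hU hi) (fun h => hkU (h ▸ hi)), ?_,
    hdisj.mono (Finset.sdiff_subset_sdiff subset_rfl (Finset.subset_insert k K))
      (Finset.sdiff_subset_sdiff subset_rfl (Finset.subset_insert k K)), hA, hB⟩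
  intro j hj
  have hj' := hV hj
  simp only [hyb, Finset.mem_union, Finset.mem_inter, Finset.mem_sdiff, Finset.mem_insert] at hj' ⊢
  by_cases hjk : j = k
  · exact Or.inl ⟨Or.inl hjk, Or.inl hjk⟩
  · rcases hj' with ⟨hη', hK⟩ | ⟨hη, hK⟩
    · exact Or.inl ⟨Or.inr hη', Or.inr hK⟩
    · exact Or.inr ⟨hη₁ j hη hjk, fun h => h.elim hjk hK⟩

/-! ### Weights -/

/-- Weights on `insert e T` for a configuration containing `e`: the factor at `e` is `q`. -/
theorem wt_insert_insert [DecidableEq ι] (T : Finset ι) {e : ι} (he : e ∉ T) (ζ : Finset ι) (q : ℝ) :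
    wt (insert e T) (insert e ζ) q = q * wt T ζ q := by
  unfold wt
  rw [Finset.prod_insert he, if_pos (Finset.mem_insert_self e ζ)]
  congr 1
  refine Finset.prod_congr rfl fun j hj => ?_
  have hje : j ≠ e := fun h => he (h ▸ hj)
  simp [Finset.mem_insert, hje]

/-- The weights of the subsets of `E` sum to `1`. -/
theorem sum_wt_eq_one [DecidableEq ι] (E : Finset ι) (q : ℝ) : ∑ η ∈ E.powerset, wt E η q = 1 := by
  induction E using Finset.induction_on with
  | empty => simp [wt]
  | @insert e T he ih =>
    rw [Finset.sum_powerset_insert he]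
    have h1 : ∀ ζ ∈ T.powerset, wt (insert e T) ζ q = (1 - q) * wt T ζ q := fun ζ hζ =>
      wt_insert_of_notMem T he (fun h => he (Finset.mem_powerset.1 hζ h)) q
    have h2 : ∀ ζ ∈ T.powerset, wt (insert e T) (insert e ζ) q = q * wt T ζ q := fun ζ _ =>
      wt_insert_insert T he ζ q
    rw [Finset.sum_congr rfl h1, Finset.sum_congr rfl h2, ← Finset.mul_sum, ← Finset.mul_sum, ih]
    ring

/-- A nonnegative `ite`. -/
theorem ite_nonneg' {P : Prop} [Decidable P] {x : ℝ} (hx : 0 ≤ x) : 0 ≤ (if P then x else 0) := by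
  split_ifs
  · exact hx
  · exact le_rfl

/-! ### The two ends of the interpolation -/

/-- `dsum E ∅ = locC E (𝒜 ∘ ℬ)`. -/
theorem dsum_empty [DecidableEq ι] (E : Finset ι) (𝒜 ℬ : Finset ι → Prop) (q : ℝ) :
    dsum E ∅ 𝒜 ℬ q = locC E (DisjOcc 𝒜 ℬ) q := by
  unfold dsum locC
  refine Finset.sum_congr rfl fun η _ => ?_
  simp only [EK_empty_iff]
  by_cases h : DisjOcc 𝒜 ℬ η
  · simp only [h, if_true]
    rw [← Finset.mul_sum, sum_wt_eq_one, mul_one]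
  · simp only [h, if_false, Finset.sum_const_zero]

/-- `dsum E E = locC E 𝒜 · locC E ℬ` for monotone `𝒜`, `ℬ`. -/
theorem dsum_self [DecidableEq ι] (E : Finset ι) {𝒜 ℬ : Finset ι → Prop}
    (hmonoA : ∀ η ζ, η ⊆ ζ → 𝒜 η → 𝒜 ζ) (hmonoB : ∀ η ζ, η ⊆ ζ → ℬ η → ℬ ζ) (q : ℝ) :
    dsum E E 𝒜 ℬ q = locC E 𝒜 q * locC E ℬ q := by
  unfold dsum locC
  rw [Finset.sum_mul_sum]
  refine Finset.sum_congr rfl fun η hη => Finset.sum_congr rfl fun η' hη' => ?_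
  rw [EK_self_iff hmonoA hmonoB (Finset.mem_powerset.1 hη) (Finset.mem_powerset.1 hη')]
  by_cases h1 : 𝒜 η <;> by_cases h2 : ℬ η' <;> simp [h1, h2]

/-! ### The one-coordinate step -/

/-- Splitting a double sum over the subsets of `insert k T` according to the coordinate `k` in both copies. -/
theorem sum_sum_powerset_insert [DecidableEq ι] (T : Finset ι) {k : ι} (hk : k ∉ T)
    (g : Finset ι → Finset ι → ℝ) :
    (∑ η ∈ (insert k T).powerset, ∑ η' ∈ (insert k T).powerset, g η η') =
      ∑ ζ ∈ T.powerset, ∑ ζ' ∈ T.powerset,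
        (g ζ ζ' + g ζ (insert k ζ') + g (insert k ζ) ζ' + g (insert k ζ) (insert k ζ')) := by
  rw [Finset.sum_powerset_insert hk]
  simp only [Finset.sum_powerset_insert hk]
  rw [← Finset.sum_add_distrib]
  refine Finset.sum_congr rfl fun ζ _ => ?_
  rw [← Finset.sum_add_distrib, ← Finset.sum_add_distrib, ← Finset.sum_add_distrib]
  refine Finset.sum_congr rfl fun ζ' _ => ?_
  ring

/-- The pointwise four-case inequality of the one-coordinate step, for fixed `ζ, ζ' ⊆ T` (`k ∉ T`). -/
theorem step_pointwise [DecidableEq ι] (T : Finset ι) {k : ι} (hkT : k ∉ T) (K : Finset ι) (hkK : k ∉ K)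
    (𝒜 ℬ : Finset ι → Prop) {q : ℝ} (hq0 : 0 ≤ q) (hq1 : q ≤ 1) {ζ ζ' : Finset ι} (hζ : ζ ⊆ T)
    (hζ' : ζ' ⊆ T) :
    ((if EK K 𝒜 ℬ ζ ζ' then wt (insert k T) ζ q * wt (insert k T) ζ' q else 0) +
      (if EK K 𝒜 ℬ ζ (insert k ζ') then wt (insert k T) ζ q * wt (insert k T) (insert k ζ') q else 0) +
      (if EK K 𝒜 ℬ (insert k ζ) ζ' then wt (insert k T) (insert k ζ) q * wt (insert k T) ζ' q else 0) +
      (if EK K 𝒜 ℬ (insert k ζ) (insert k ζ') then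
        wt (insert k T) (insert k ζ) q * wt (insert k T) (insert k ζ') q else 0)) ≤
    ((if EK (insert k K) 𝒜 ℬ ζ ζ' then wt (insert k T) ζ q * wt (insert k T) ζ' q else 0) +
      (if EK (insert k K) 𝒜 ℬ ζ (insert k ζ') then
        wt (insert k T) ζ q * wt (insert k T) (insert k ζ') q else 0) +
      (if EK (insert k K) 𝒜 ℬ (insert k ζ) ζ' then
        wt (insert k T) (insert k ζ) q * wt (insert k T) ζ' q else 0) +
      (if EK (insert k K) 𝒜 ℬ (insert k ζ) (insert k ζ') then
        wt (insert k T) (insert k ζ) q * wt (insert k T) (insert k ζ') q else 0)) := by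
  have hζk : k ∉ ζ := fun h => hkT (hζ h)
  have hζ'k : k ∉ ζ' := fun h => hkT (hζ' h)
  rw [wt_insert_of_notMem T hkT hζk, wt_insert_of_notMem T hkT hζ'k, wt_insert_insert T hkT ζ,
    wt_insert_insert T hkT ζ']
  have ha : 0 ≤ wt T ζ q := wt_nonneg T ζ hq0 hq1
  have hb : 0 ≤ wt T ζ' q := wt_nonneg T ζ' hq0 hq1
  set a := wt T ζ q with ha_def
  set b := wt T ζ' q with hb_def
  have hab : 0 ≤ a * b := mul_nonneg ha hb
  have hq' : 0 ≤ 1 - q := by linarith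
  have t1 : 0 ≤ (if EK (insert k K) 𝒜 ℬ ζ ζ' then (1 - q) * a * ((1 - q) * b) else 0) :=
    ite_nonneg' (by positivity)
  have t2 : 0 ≤ (if EK (insert k K) 𝒜 ℬ ζ (insert k ζ') then (1 - q) * a * (q * b) else 0) :=
    ite_nonneg' (by positivity)
  have t3 : 0 ≤ (if EK (insert k K) 𝒜 ℬ (insert k ζ) ζ' then q * a * ((1 - q) * b) else 0) :=
    ite_nonneg' (by positivity)
  have t4 : 0 ≤ (if EK (insert k K) 𝒜 ℬ (insert k ζ) (insert k ζ') then q * a * (q * b) else 0) :=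
    ite_nonneg' (by positivity)
  simp only [EK_insert_right hkK]
  by_cases h1 : EK K 𝒜 ℬ ζ ζ'
  · -- case A: the witnesses avoid `k`; all four events hold after the split
    have e1 : EK (insert k K) 𝒜 ℬ ζ ζ' := EK_insert_of_notMem hkK hζk h1 subset_rfl subset_rfl
    have e2 : EK (insert k K) 𝒜 ℬ ζ (insert k ζ') :=
      EK_insert_of_notMem hkK hζk h1 subset_rfl (Finset.subset_insert _ _)
    have e3 : EK (insert k K) 𝒜 ℬ (insert k ζ) ζ' :=
      EK_insert_of_notMem hkK hζk h1 (Finset.subset_insert _ _) subset_rfl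
    have e4 : EK (insert k K) 𝒜 ℬ (insert k ζ) (insert k ζ') :=
      EK_insert_of_notMem hkK hζk h1 (Finset.subset_insert _ _) (Finset.subset_insert _ _)
    by_cases h2 : EK K 𝒜 ℬ (insert k ζ) ζ'
    · simp only [h1, h2, e1, e2, e3, e4, if_true]
      exact le_rfl
    · simp only [h1, h2, e1, e2, e3, e4, if_true, if_false]
      nlinarith
  · by_cases h2 : EK K 𝒜 ℬ (insert k ζ) ζ'
    · -- case B: `k` must be open; the witness containing `k` is served by the copy it reads
      obtain ⟨U, V, hU, hV, hdisj, hA, hB⟩ := id h2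
      by_cases hkU : k ∈ U
      · have e3 : EK (insert k K) 𝒜 ℬ (insert k ζ) ζ' :=
          EK_insert_of_mem_left hkK hU hV hdisj hA hB hkU subset_rfl
        have e4 : EK (insert k K) 𝒜 ℬ (insert k ζ) (insert k ζ') :=
          EK_insert_of_mem_left hkK hU hV hdisj hA hB hkU (Finset.subset_insert _ _)
        simp only [h1, h2, e3, e4, if_true, if_false]
        simp only [e3, e4, if_true] at t3 t4
        nlinarith
      · have e2 : EK (insert k K) 𝒜 ℬ ζ (insert k ζ') :=
          EK_insert_of_notMem_left hU hV hdisj hA hB hkU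
            (fun j hj hjk => (Finset.mem_insert.1 hj).resolve_left hjk)
        have e4 : EK (insert k K) 𝒜 ℬ (insert k ζ) (insert k ζ') :=
          EK_insert_of_notMem_left hU hV hdisj hA hB hkU (fun j hj _ => hj)
        simp only [h1, h2, e2, e4, if_true, if_false]
        nlinarith
    · -- case C: nothing to show
      simp only [h1, h2, if_false, add_zero]
      linarith

/-- **The one-coordinate step**: splitting one more coordinate does not decrease the doubled sum. -/
theorem dsum_le_dsum_insert [DecidableEq ι] (T : Finset ι) {k : ι} (hkT : k ∉ T) (K : Finset ι) (hkK : k ∉ K)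
    (𝒜 ℬ : Finset ι → Prop) {q : ℝ} (hq0 : 0 ≤ q) (hq1 : q ≤ 1) :
    dsum (insert k T) K 𝒜 ℬ q ≤ dsum (insert k T) (insert k K) 𝒜 ℬ q := by
  unfold dsum
  rw [sum_sum_powerset_insert T hkT, sum_sum_powerset_insert T hkT]
  refine Finset.sum_le_sum fun ζ hζ => Finset.sum_le_sum fun ζ' hζ' => ?_
  exact step_pointwise T hkT K hkK 𝒜 ℬ hq0 hq1 (Finset.mem_powerset.1 hζ) (Finset.mem_powerset.1 hζ')

/-- The doubled sum at `∅` is at most the doubled sum at any `K ⊆ E`. -/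
theorem dsum_empty_le [DecidableEq ι] (E : Finset ι) (𝒜 ℬ : Finset ι → Prop) {q : ℝ} (hq0 : 0 ≤ q)
    (hq1 : q ≤ 1) : ∀ K ⊆ E, dsum E ∅ 𝒜 ℬ q ≤ dsum E K 𝒜 ℬ q := by
  intro K
  induction K using Finset.induction_on with
  | empty => intro _; exact le_rfl
  | @insert k K hkK ih =>
    intro hKE
    have hkE : k ∈ E := hKE (Finset.mem_insert_self k K)
    have hKE' : K ⊆ E := (Finset.subset_insert k K).trans hKE
    refine (ih hKE').trans ?_
    have := dsum_le_dsum_insert (E.erase k) (Finset.notMem_erase k E) K hkK 𝒜 ℬ hq0 hq1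
    rwa [Finset.insert_erase hkE] at this

/-- **BK on the subsets of a finite set**: `locC E (𝒜 ∘ ℬ) q ≤ locC E 𝒜 q · locC E ℬ q` for monotone `𝒜`, `ℬ` and
`q ∈ [0,1]`. -/
theorem locC_disjOcc_le [DecidableEq ι] (E : Finset ι) {𝒜 ℬ : Finset ι → Prop}
    (hmonoA : ∀ η ζ, η ⊆ ζ → 𝒜 η → 𝒜 ζ) (hmonoB : ∀ η ζ, η ⊆ ζ → ℬ η → ℬ ζ) {q : ℝ} (hq0 : 0 ≤ q)
    (hq1 : q ≤ 1) : locC E (DisjOcc 𝒜 ℬ) q ≤ locC E 𝒜 q * locC E ℬ q := by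
  rw [← dsum_empty E 𝒜 ℬ q, ← dsum_self E hmonoA hmonoB q]
  exact dsum_empty_le E 𝒜 ℬ hq0 hq1 E subset_rfl

end Summit.Ventures.PercRepro0.BKFinite
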